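import Mathlib
import HarnessLib
import Summits.CriticalPhenomena.PercolationContinuityZ3.Theses.PercPotemkinWeaver

/-!
# Line `x1-nonproliferation-pigeonhole` — birth skeleton of `FKGGiantBoxDensity`
(X₁ of the split of `FKGHalfSpaceRigidity`; item `stmt-CriticalPhenomena-18904`, route `PercPotemkinWeaver`)

`FKGGiantBoxDensity` ("FKG giants are monolithic") ⟸ two stubs and a proved composition:

* `stub_giantVolume_ae` — VOLUME (ergodic theorem): a.s. for all large `n` the inner box `Λ_{n/2}` holds
  `≥ θ₀|Λ_n|` infinite-cluster vertices (true for every stationary ergodic `μ` with `θ > 0`; pointwise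
  ergodic theorem for the `ℤ³`-shift action — not in Mathlib in this form, size M/L);
* `stub_nonProliferation_ae` — NON-PROLIFERATION (the content): for some `M`, a.s. for all large `n`
  the infinite-cluster vertices of `Λ_{n/2}` are covered by `≤ M` box-clusters of `Λ_n` (monolithic:
  `M = 1`; shattered giants have unboundedly many crossing pieces) — where positive association must bite;
* `FKGGiantBoxDensity_of` — PROVED composition: pigeonhole (`exists_dense_of_cover`: some covering
  box-cluster has `≥ θ₀/(M+1)·|Λ_n|` vertices) pointwise, then "a.s. eventually" ⇒ "probability → 1" by
  continuity of measure along the increasing tails `{∀ m ≥ N, Λ_m has a dense piece}` (no measurability needed).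
-/

namespace Summit.CriticalPhenomena.PercolationContinuityZ3.Cruxes.FKGGiantBoxDensity.NonProliferationPigeonhole

open MeasureTheory Filter
open scoped Topology
open Summit.CriticalPhenomena.PercolationContinuityZ3.Theses.PercPotemkinWeaver (FKGGiantBoxDensity)

/-- STUB 1 statement (volume of the giant, ergodic theorem): for some `θ₀ > 0`, a.s. for all large `n`
the inner box `Λ_{n/2}` holds at least `θ₀ |Λ_n|` infinite-cluster vertices. -/
def GiantVolumeAE : Prop :=
  ∀ μ : MeasureTheory.Measure (Literature.Probability.Percolation.BondConfig (Literature.Probability.LatticeModels.Site 3)), MeasureTheory.IsProbabilityMeasure μ → (∀ᵐ ω ∂μ, ω ⊆ (Literature.Probability.LatticeModels.zdGraph 3).edgeSet) → (∀ (v : Literature.Probability.LatticeModels.Site 3) (S : Set (Literature.Probability.Percolation.BondConfig (Literature.Probability.LatticeModels.Site 3))), MeasurableSet S → μ (Literature.Probability.Percolation.BondConfig.relabel (Literature.Probability.Percolation.sym2Equiv (Literature.Probability.LatticeModels.Site.shift v)) ⁻¹' S) = μ S) → (∀ S : Set (Literature.Probability.Percolation.BondConfig (Literature.Probability.LatticeModels.Site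 3)), MeasurableSet S → (∀ v : Literature.Probability.LatticeModels.Site 3, Literature.Probability.Percolation.BondConfig.relabel (Literature.Probability.Percolation.sym2Equiv (Literature.Probability.LatticeModels.Site.shift v)) ⁻¹' S = S) → μ S = 0 ∨ μ S = 1) → (∀ N : ℕ, ∃ c : ℝ, 0 < c ∧ ∀ S : Set (Literature.Probability.Percolation.BondConfig (Literature.Probability.LatticeModels.Site 3)), MeasurableSet S → c * μ.real ((fun ω : Literature.Probability.Percolation.BondConfig (Literature.Probability.LatticeModels.Site 3) => ω ∪ ↑(Literature.Probability.LatticeModels.edgesIn (Literature.Probability.LatticeModels.zdGraph 3) (Literature.Probability.LatticeModels.box 3 N))) ⁻¹' S) ≤ μ.real S) → (∀ N : ℕ, ∃ c : ℝ, 0 < c ∧ ∀ S : Set (Literature.Probability.Percolation.BondConfig (Literature.Probability.LatticeModels.Site 3)), MeasurableSet S → c * μ.real ((fun ω : Literature.Probability.Percolation.BondConfig (Literature.Probability.LatticeModels.Site 3) => ω \ ↑(Literature.Probability.LatticeModels.edgesIn (Literature.Probability.LatticeModels.zdGraph 3) (Literature.Probability.LatticeModels.box 3 N))) ⁻¹'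 S) ≤ μ.real S) → (∀ v : Literature.Probability.LatticeModels.Site 3, v ≠ 0 → Ergodic (Literature.Probability.Percolation.BondConfig.relabel (Literature.Probability.Percolation.sym2Equiv (Literature.Probability.LatticeModels.Site.shift v))) μ) → (∀ (γ : Literature.Probability.LatticeModels.zdGraph 3 ≃g Literature.Probability.LatticeModels.zdGraph 3) (A : Set (Literature.Probability.Percolation.BondConfig (Literature.Probability.LatticeModels.Site 3))), MeasurableSet A → μ (Literature.Probability.Percolation.BondConfig.relabel (Literature.Probability.Percolation.sym2Equiv γ.toEquiv) ⁻¹' A) = μ A) → (∀ A B : Set (Literature.Probability.Percolation.BondConfig (Literature.Probability.LatticeModels.Site 3)), IsUpperSet A → IsUpperSet B → MeasurableSet A → MeasurableSet B → μ A * μ B ≤ μ (A ∩ B)) → 0 < μ.real (Literature.Probability.Percolation.percolatesAt (0 : Literature.Probability.LatticeModels.Site 3)) → (∀ᵐ ω ∂μ, Literature.Probability.Percolation.numInfiniteClusters ω = 1) → ∃ θ₀ : ℝ, 0 < θ₀ ∧ ∀ᵐ ω ∂μ, ∃ N : ℕ, ∀ n : ℕ, N ≤ n → θ₀ * ((Literature.Probability.LatticeModels.box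 3 n).card : ℝ) ≤ (({x : Literature.Probability.LatticeModels.Site 3 | x ∈ Literature.Probability.LatticeModels.box 3 (n / 2) ∧ ω ∈ Literature.Probability.Percolation.percolatesAt x}).ncard : ℝ)

/-- STUB 2 statement (NON-PROLIFERATION): for some `M`, a.s. for all large `n` the infinite-cluster
vertices of `Λ_{n/2}` are covered by at most `M` box-clusters of `Λ_n`. -/
def NonProliferationAE : Prop :=
  ∀ μ : MeasureTheory.Measure (Literature.Probability.Percolation.BondConfig (Literature.Probability.LatticeModels.Site 3)), MeasureTheory.IsProbabilityMeasure μ → (∀ᵐ ω ∂μ, ω ⊆ (Literature.Probability.LatticeModels.zdGraph 3).edgeSet) → (∀ (v : Literature.Probability.LatticeModels.Site 3) (S : Set (Literature.Probability.Percolation.BondConfig (Literature.Probability.LatticeModels.Site 3))), MeasurableSet S → μ (Literature.Probability.Percolation.BondConfig.relabel (Literature.Probability.Percolation.sym2Equiv (Literature.Probability.LatticeModels.Site.shift v)) ⁻¹' S) = μ S) → (∀ S : Set (Literature.Probability.Percolation.BondConfig (Literature.Probability.LatticeModels.Site 3)), MeasurableSet S → (∀ v : Literature.Probability.LatticeModels.Site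 3, Literature.Probability.Percolation.BondConfig.relabel (Literature.Probability.Percolation.sym2Equiv (Literature.Probability.LatticeModels.Site.shift v)) ⁻¹' S = S) → μ S = 0 ∨ μ S = 1) → (∀ N : ℕ, ∃ c : ℝ, 0 < c ∧ ∀ S : Set (Literature.Probability.Percolation.BondConfig (Literature.Probability.LatticeModels.Site 3)), MeasurableSet S → c * μ.real ((fun ω : Literature.Probability.Percolation.BondConfig (Literature.Probability.LatticeModels.Site 3) => ω ∪ ↑(Literature.Probability.LatticeModels.edgesIn (Literature.Probability.LatticeModels.zdGraph 3) (Literature.Probability.LatticeModels.box 3 N))) ⁻¹' S) ≤ μ.real S) → (∀ N : ℕ, ∃ c : ℝ, 0 < c ∧ ∀ S : Set (Literature.Probability.Percolation.BondConfig (Literature.Probability.LatticeModels.Site 3)), MeasurableSet S → c * μ.real ((fun ω : Literature.Probability.Percolation.BondConfig (Literature.Probability.LatticeModels.Site 3) => ω \ ↑(Literature.Probability.LatticeModels.edgesIn (Literature.Probability.LatticeModels.zdGraph 3) (Literature.Probability.LatticeModels.box 3 N))) ⁻¹' S) ≤ μ.real S) → (∀ v : Literature.Probability.LatticeModels.Site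 3, v ≠ 0 → Ergodic (Literature.Probability.Percolation.BondConfig.relabel (Literature.Probability.Percolation.sym2Equiv (Literature.Probability.LatticeModels.Site.shift v))) μ) → (∀ (γ : Literature.Probability.LatticeModels.zdGraph 3 ≃g Literature.Probability.LatticeModels.zdGraph 3) (A : Set (Literature.Probability.Percolation.BondConfig (Literature.Probability.LatticeModels.Site 3))), MeasurableSet A → μ (Literature.Probability.Percolation.BondConfig.relabel (Literature.Probability.Percolation.sym2Equiv γ.toEquiv) ⁻¹' A) = μ A) → (∀ A B : Set (Literature.Probability.Percolation.BondConfig (Literature.Probability.LatticeModels.Site 3)), IsUpperSet A → IsUpperSet B → MeasurableSet A → MeasurableSet B → μ A * μ B ≤ μ (A ∩ B)) → 0 < μ.real (Literature.Probability.Percolation.percolatesAt (0 : Literature.Probability.LatticeModels.Site 3)) → (∀ᵐ ω ∂μ, Literature.Probability.Percolation.numInfiniteClusters ω = 1) → ∃ M : ℕ, ∀ᵐ ω ∂μ, ∃ N : ℕ, ∀ n : ℕ, N ≤ n → ∃ T : Finset (Literature.Probability.LatticeModels.Site 3), T.card ≤ M ∧ ∀ x ∈ Literature.Probability.LatticeModels.box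 3 (n / 2), ω ∈ Literature.Probability.Percolation.percolatesAt x → ∃ t ∈ T, ω ∈ Literature.Probability.Percolation.openConnIn (↑(Literature.Probability.LatticeModels.box 3 n) : Set (Literature.Probability.LatticeModels.Site 3)) t x

/-- **Stub 1 — volume of the giant (ergodic theorem).** Under the soft portrait with `θ > 0` and a
unique infinite cluster, for some `θ₀ > 0`, almost surely for all large `n` the inner box `Λ_{n/2}`
contains at least `θ₀ |Λ_n|` vertices of infinite clusters (pointwise ergodic theorem for the
`ℤ³`-shift action applied to `1{|C(0)| = ∞}`, density `θ = μ(|C(0)| = ∞)`; `θ₀ = θ/64` works). -/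
theorem stub_giantVolume_ae : GiantVolumeAE := by
  sorry

/-- **Stub 2 — NON-PROLIFERATION for FKG giants (the content of X₁).** Under the same hypotheses
there is `M` such that, almost surely for all large `n`, the infinite-cluster vertices of the inner
box `Λ_{n/2}` are covered by at most `M` box-clusters of `Λ_n` (components of the open subgraph
induced on `Λ_n`): a monolithic giant has `M = 1` eventually (supercritical Bernoulli: uniqueness of
the crossing cluster, summable error), a shattered one has unboundedly many crossing pieces. -/
theorem stub_nonProliferation_ae : NonProliferationAE := by
  sorry

namespace Registered
/-- registered stub signature -/
abbrev stub_giantVolume_ae : Prop := GiantVolumeAE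
/-- registered stub signature -/
abbrev stub_nonProliferation_ae : Prop := NonProliferationAE
end Registered

/-- Membership in `{x ↔ y in S}` forces `y ∈ S`. [folklore] -/
theorem mem_of_openConnIn {S : Set (Literature.Probability.LatticeModels.Site 3)} {x y : Literature.Probability.LatticeModels.Site 3}
    {ω : Literature.Probability.Percolation.BondConfig (Literature.Probability.LatticeModels.Site 3)} (h : ω ∈ Literature.Probability.Percolation.openConnIn S x y) : y ∈ S := by
  obtain ⟨-, hy, -⟩ := h
  exact hy

/-- Membership in `{x ↔ y in S}` forces `x ∈ S`. [folklore] -/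
theorem mem_of_openConnIn_left {S : Set (Literature.Probability.LatticeModels.Site 3)} {x y : Literature.Probability.LatticeModels.Site 3}
    {ω : Literature.Probability.Percolation.BondConfig (Literature.Probability.LatticeModels.Site 3)} (h : ω ∈ Literature.Probability.Percolation.openConnIn S x y) : x ∈ S := by
  obtain ⟨hx, -, -⟩ := h
  exact hx

/-- **Pigeonhole.** If the infinite-cluster vertices of `Λ_{n/2}` number at least `θ₀|Λ_n|` and are
covered by at most `M` box-clusters of `Λ_n`, one box-cluster of `Λ_n` has at least
`θ₀/(M+1) · |Λ_n|` vertices. [folklore] -/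
theorem exists_dense_of_cover {n M : ℕ} {θ₀ : ℝ} {ω : Literature.Probability.Percolation.BondConfig (Literature.Probability.LatticeModels.Site 3)}
    {T : Finset (Literature.Probability.LatticeModels.Site 3)} (hθ₀ : 0 < θ₀) (hTM : T.card ≤ M)
    (hvol : θ₀ * ((Literature.Probability.LatticeModels.box 3 n).card : ℝ) ≤ (({x : Literature.Probability.LatticeModels.Site 3 | x ∈ Literature.Probability.LatticeModels.box 3 (n / 2) ∧ ω ∈ Literature.Probability.Percolation.percolatesAt x}).ncard : ℝ))
    (hcov : ∀ x ∈ Literature.Probability.LatticeModels.box 3 (n / 2), ω ∈ Literature.Probability.Percolation.percolatesAt x →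
      ∃ t ∈ T, ω ∈ Literature.Probability.Percolation.openConnIn (↑(Literature.Probability.LatticeModels.box 3 n) : Set (Literature.Probability.LatticeModels.Site 3)) t x) :
    ∃ x ∈ Literature.Probability.LatticeModels.box 3 n, θ₀ / (M + 1) * ((Literature.Probability.LatticeModels.box 3 n).card : ℝ) ≤
      (({y : Literature.Probability.LatticeModels.Site 3 | ω ∈ Literature.Probability.Percolation.openConnIn (↑(Literature.Probability.LatticeModels.box 3 n) : Set (Literature.Probability.LatticeModels.Site 3)) x y}).ncard : ℝ) := by
  classical
  set A := (Literature.Probability.LatticeModels.box 3 (n / 2)).filter (fun x => ω ∈ Literature.Probability.Percolation.percolatesAt x) with hA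
  have hAvol : (({x : Literature.Probability.LatticeModels.Site 3 | x ∈ Literature.Probability.LatticeModels.box 3 (n / 2) ∧ ω ∈ Literature.Probability.Percolation.percolatesAt x}).ncard : ℝ) = (A.card : ℝ) := by
    have hset : ({x : Literature.Probability.LatticeModels.Site 3 | x ∈ Literature.Probability.LatticeModels.box 3 (n / 2) ∧ ω ∈ Literature.Probability.Percolation.percolatesAt x}) = ↑A := by
      ext x
      rw [hA, Finset.coe_filter]
    rw [hset, Set.ncard_coe_finset]
  rw [hAvol] at hvol
  set C : Literature.Probability.LatticeModels.Site 3 → Finset (Literature.Probability.LatticeModels.Site 3) := fun t =>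
    (Literature.Probability.LatticeModels.box 3 n).filter (fun y => ω ∈ Literature.Probability.Percolation.openConnIn (↑(Literature.Probability.LatticeModels.box 3 n) : Set (Literature.Probability.LatticeModels.Site 3)) t y) with hC
  have hbox : (0 : ℝ) < ((Literature.Probability.LatticeModels.box 3 n).card : ℝ) := by
    rw [Literature.Probability.LatticeModels.card_box]; positivity
  -- the cover
  have hsub : A ⊆ T.biUnion C := by
    intro x hx
    rw [hA, Finset.mem_filter] at hx
    obtain ⟨t, ht, hconn⟩ := hcov x hx.1 hx.2
    rw [Finset.mem_biUnion]
    exact ⟨t, ht, by rw [hC, Finset.mem_filter]; exact ⟨mem_of_openConnIn hconn, hconn⟩⟩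
  have hcard : (A.card : ℝ) ≤ ∑ t ∈ T, ((C t).card : ℝ) := by
    have h := (Finset.card_le_card hsub).trans Finset.card_biUnion_le
    exact_mod_cast h
  -- some piece is large
  by_contra hcon
  push Not at hcon
  have hlt : ∀ t ∈ T, ((C t).card : ℝ) < θ₀ / (M + 1) * ((Literature.Probability.LatticeModels.box 3 n).card : ℝ) := by
    intro t ht
    by_cases htb : t ∈ Literature.Probability.LatticeModels.box 3 n
    · have h := hcon t htb
      have hset : ({y : Literature.Probability.LatticeModels.Site 3 | ω ∈ Literature.Probability.Percolation.openConnIn (↑(Literature.Probability.LatticeModels.box 3 n) : Set (Literature.Probability.LatticeModels.Site 3)) t y}) = ↑(C t) := by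
        ext y
        rw [hC]
        simp only [Set.mem_setOf_eq, Finset.coe_filter]
        exact ⟨fun hy => ⟨mem_of_openConnIn hy, hy⟩, fun hy => hy.2⟩
      rw [hset, Set.ncard_coe_finset] at h
      exact h
    · have hempty : C t = ∅ := by
        rw [hC, Finset.filter_eq_empty_iff]
        intro y _ hconn
        exact htb (mem_of_openConnIn_left hconn)
      rw [hempty, Finset.card_empty, Nat.cast_zero]
      positivity
  have hM : (0 : ℝ) < (M : ℝ) + 1 := by positivity
  have hsum : ∑ t ∈ T, ((C t).card : ℝ) ≤ (T.card : ℝ) * (θ₀ / (M + 1) * ((Literature.Probability.LatticeModels.box 3 n).card : ℝ)) := by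
    have h := Finset.sum_le_card_nsmul T (fun t => ((C t).card : ℝ)) _ (fun t ht => (hlt t ht).le)
    rwa [nsmul_eq_mul] at h
  have hTM' : (T.card : ℝ) ≤ M := by exact_mod_cast hTM
  have h1 : (T.card : ℝ) * (θ₀ / (M + 1) * ((Literature.Probability.LatticeModels.box 3 n).card : ℝ)) ≤
      (M : ℝ) * (θ₀ / (M + 1) * ((Literature.Probability.LatticeModels.box 3 n).card : ℝ)) :=
    mul_le_mul_of_nonneg_right hTM' (by positivity)
  have h2 : (M : ℝ) * (θ₀ / (M + 1) * ((Literature.Probability.LatticeModels.box 3 n).card : ℝ)) < θ₀ * ((Literature.Probability.LatticeModels.box 3 n).card : ℝ) := by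
    have : (M : ℝ) * (θ₀ / (M + 1)) < θ₀ := by
      rw [mul_div_assoc', div_lt_iff₀ hM]
      nlinarith
    nlinarith
  linarith

/-- **Composition**: `stub_giantVolume_ae → stub_nonProliferation_ae → FKGGiantBoxDensity`
(pigeonhole pointwise, then "a.s. eventually" ⇒ "with probability → 1" by continuity of measure along
the increasing events `{∀ m ≥ N, Λ_m has a dense piece}`). -/
theorem FKGGiantBoxDensity_of (h₁ : Registered.stub_giantVolume_ae)
    (h₂ : Registered.stub_nonProliferation_ae) : FKGGiantBoxDensity := by
  intro μ hμ hsupp hshift hzo hins hdel herg haut hfkg hθ hU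
  haveI : IsProbabilityMeasure μ := hμ
  obtain ⟨θ₀, hθ₀, hV⟩ := h₁ μ hμ hsupp hshift hzo hins hdel herg haut hfkg hθ hU
  obtain ⟨M, hNP⟩ := h₂ μ hμ hsupp hshift hzo hins hdel herg haut hfkg hθ hU
  refine ⟨θ₀ / (M + 1), by positivity, fun η hη => ?_⟩
  -- the dense events and their tails
  set D : ℕ → Set (Literature.Probability.Percolation.BondConfig (Literature.Probability.LatticeModels.Site 3)) := fun n =>
    {ω | ∃ x ∈ Literature.Probability.LatticeModels.box 3 n, θ₀ / (M + 1) * ((Literature.Probability.LatticeModels.box 3 n).card : ℝ) ≤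
      (({y : Literature.Probability.LatticeModels.Site 3 | ω ∈ Literature.Probability.Percolation.openConnIn (↑(Literature.Probability.LatticeModels.box 3 n) : Set (Literature.Probability.LatticeModels.Site 3)) x y}).ncard : ℝ)} with hD
  set E : ℕ → Set (Literature.Probability.Percolation.BondConfig (Literature.Probability.LatticeModels.Site 3)) := fun N => {ω | ∀ n, N ≤ n → ω ∈ D n} with hE
  -- a.s. eventually dense (pigeonhole)
  have hae : ∀ᵐ ω ∂μ, ∃ N : ℕ, ω ∈ E N := by
    filter_upwards [hV, hNP] with ω hVω hNPω
    obtain ⟨N₁, hN₁⟩ := hVω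
    obtain ⟨N₂, hN₂⟩ := hNPω
    refine ⟨max N₁ N₂, fun n hn => ?_⟩
    obtain ⟨T, hTM, hcov⟩ := hN₂ n (le_of_max_le_right hn)
    exact exists_dense_of_cover hθ₀ hTM (hN₁ n (le_of_max_le_left hn)) hcov
  -- the tails increase to a set of full measure
  have hmono : Monotone E := fun N N' hNN' ω hω n hn => hω n (hNN'.trans hn)
  have hcompl : μ (⋃ N, E N)ᶜ = 0 := by
    have h := ae_iff.1 hae
    have hset : (⋃ N, E N)ᶜ = {ω | ¬ ∃ N : ℕ, ω ∈ E N} := by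
      ext ω
      simp only [Set.mem_compl_iff, Set.mem_iUnion, Set.mem_setOf_eq]
    rw [hset]
    exact h
  have hone : μ (⋃ N, E N) = 1 := by
    apply le_antisymm prob_le_one
    calc (1 : ENNReal) = μ Set.univ := measure_univ.symm
      _ = μ ((⋃ N, E N) ∪ (⋃ N, E N)ᶜ) := by rw [Set.union_compl_self]
      _ ≤ μ (⋃ N, E N) + μ (⋃ N, E N)ᶜ := measure_union_le _ _
      _ = μ (⋃ N, E N) := by rw [hcompl, add_zero]
  have hT : Tendsto (fun N => (μ (E N)).toReal) atTop (𝓝 1) := by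
    have h := (ENNReal.tendsto_toReal (ENNReal.one_ne_top)).comp
      ((tendsto_measure_iUnion_atTop hmono).trans (by rw [hone]))
    exact h
  obtain ⟨N, hN⟩ := Filter.eventually_atTop.1 (hT.eventually (eventually_gt_nhds (by linarith : (1 : ℝ) - η < 1)))
  refine ⟨N, fun n hn => ?_⟩
  have hsubset : E N ⊆ D n := fun ω hω => hω n hn
  have hle : (μ (E N)).toReal ≤ μ.real (D n) := by
    rw [← measureReal_def]
    exact measureReal_mono hsubset
  have := hN N le_rfl
  change 1 - η ≤ μ.real (D n)
  linarith

end Summit.CriticalPhenomena.PercolationContinuityZ3.Cruxes.FKGGiantBoxDensity.NonProliferationPigeonhole
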